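import Mathlib.LinearAlgebra.SymplecticGroup
import Literature.Barriers.MatrixMultiplication.QuasirandomBarrierLieType
import HarnessLib

/-!
# Barrier (sequel to `QuasirandomBarrierLieType.lean`): BCGPU 2023, Cor. 3.4 for the symplectic
# groups `Sp(2n, q)` and their central quotients `PSp(2n, q)` (type `C`) — named fact

Topic `Literature/Barriers/MatrixMultiplication` (D-0021 catalogue for the summit
`MatrixMultiplication`, `ω(ℂ) = 2`); attached to the catalogue entry `QuasirandomBarrier`
(Thm. 3.2 = `BCGPU2023_thm32`, PROVED).  `QuasirandomBarrierLieType.lean` typed Cor. 3.4 for the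
type-`A` families `SL(n, q)`, `PSL(n, q)` (`BCGPU2023_cor34_typeA`, since PROVED:
`BCGPU2023_cor34_typeA_holds`, `QuasirandomBarrierLieTypeProofs.lean`) and recorded the other
families as "not expressible in Mathlib today … (`Sp` exists as `Matrix.symplecticGroup` but
without the finite-field theory)".  The STATEMENT for type `C` needs no finite-field theory: Mathlib's
`Matrix.symplecticGroup l F` (the matrices `A` with `A J Aᵀ = J`, `J = [[0, −1], [1, 0]]`, a `Group`)
over a finite field `F` with `l = Fin n` is the finite symplectic group `Sp(2n, q)` — the
(universal) Chevalley group of type `C_n` over `𝔽_q`, one of the families the paper lists by name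
(footnote 2, p. 3: "Among others, this list includes `SL(n,q)`, `SU(n,q)`, `SO(2n+1,q)`, `Sp(2n,q)`,
`SO^+(2n,q)`, and `SO^-(2n,q)`. Obtaining simple groups can require taking the quotient by the
center, but that does not change our conclusions, such as Cor. 3.4") — all non-degenerate
alternating forms on `𝔽_q^{2n}` being equivalent, the choice of `J` is immaterial.  This file types
Cor. 3.4 for that family as a named fact, in exactly the effective form of `BCGPU2023_cor34_typeA`.

Source: J. Blasiak, H. Cohn, J. A. Grochow, K. Pratt, C. Umans, *Matrix multiplication via matrix
groups*, ITCS 2023 = arXiv:2204.03826 [BlasiakCohnGrochowPrattUmans2023]; held copy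
`paper:arxiv-2204.03826` read with `lit read` this session: p. 3 (footnote 2, quoted above), p. 6
(Cor. 3.4: "There exists a constant `ε>0` such that no triple product property construction in a
group of Lie type can yield an upper bound on `ω` better than `2+ε`", with its proof: bounded rank
by Cor. 3.3 and `n(G) ≥ Ω(|G|^δ)` [Landazuri–Seitz]; rank `r`, dimension `d`: `|G| = Θ(q^d)`,
`n(G) ≥ Ω(q^r)` [Landazuri–Seitz], `O(q^r)` conjugacy classes [Fulman–Guralnick], convexity,
"`ω ≤ 3(r + log_q C)/r`"), p. 7 ("this corollary holds not just for groups of Lie type, but also for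
simple groups that are quotients of groups of Lie type by their centers").

## Rendering and wording risks

* As for type `A`: "cannot yield an upper bound on `ω` better than `2 + ε` via Thm. 2.2" is rendered
  by "the inequality of Thm. 2.2 HOLDS at `w = 2 + ε`", `(|S||T||U|)^{(2+ε)/3} ≤ ∑ᵢ dᵢ^{2+ε}`
  (`charDegreePowSum`); one absolute `ε` for the whole family (every `n ≥ 1`, every finite field),
  as printed (one `ε` for all groups of Lie type; a separate `∃ ε` per family is WEAKER than print,
  never stronger); `PSp(2n, q)` = the quotient of `Sp(2n, q)` by its centre (`{±1}` for odd `q`).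
* For type `C_n` the printed inputs are `n(Sp(2n,q)) ≥ (qⁿ − 1)/2` (Landazuri–Seitz 1974, table
  p. 419: `½(qⁿ − 1)` for `q` odd, a larger bound for `q` even [cite: LandazuriSeitz1974, §1 (table, p. 419)])
  and `k(Sp(2n,q)) ≤ 15.2 qⁿ` (Fulman–Guralnick 2012, held copy read: Thm. 3.12 (`q` odd,
  `≤ 10.8 qⁿ`), Thm. 3.13 (`q` even, `≤ 15.2 qⁿ`), Thm. 1.1 (1) in general
  [cite: FulmanGuralnick2012, Thm. 1.1 (1) and Thms. 3.12-3.13]); the class-number input is not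
  in the tree, so the fact is statement-only.  REDUCTIONS: (2026-08-27,
  `QuasirandomBarrierLieTypeCReduction.lean`) `BCGPU2023_cor34_typeC_of_inputs` PROVES this fact
  from the two printed inputs stated inline as hypotheses — (LS) `qⁿ/4 ≤ n(Sp(2n, 𝔽_q))` and (FG)
  `k(Sp(2n, 𝔽_q)) ≤ q^{5n}`, all `n ≥ 1`, all finite fields — via the uniform-`ε` engine
  `exists_eps_noCertificate_family_gen 5 4`; (2026-08-27, later) the minimal-degree input is now
  PROVED in the weak form `n(Sp(2n, q)) ≥ q^{n−1} − 1` (`n ≥ 3`), `≥ (q − 1)/2` (all `n`)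
  (`Literature/RepresentationTheory/FiniteGroups/SpMinimalCharacterDegree.lean`:
  `Sp2n.le_charDegree_of_three_le` etc., by restriction to the Siegel Levi factor `SL_n(q)`, whose
  normal closure is `Sp_{2n}(q)` — `Literature/LinearAlgebra/Matrix/SymplecticGroupGeneration.lean`,
  Artin Thm. 3.25 / 5.1), which serves with rank parameter `r = n − 1`, and
  `QuasirandomBarrierLieTypeCOfClassNumber.lean` proves **`BCGPU2023_cor34_typeC_of_classNumber`**:
  this fact follows from (FG) ALONE.  The discharge is therefore exactly the task of proving (FG)
  `k(Sp(2n, 𝔽_q)) ≤ q^{5n}` for `Matrix.symplecticGroup (Fin n) F`.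
* Still NOT typed (no Mathlib carrier with the right group): `SU(n, q)` (no Frobenius-unitary group
  over `𝔽_{q²}`), `SO(2n+1, q)`, `SO^±(2n, q)` / `Ω` (Mathlib's `Matrix.orthogonalGroup` is the full
  orthogonal group of the standard form, not the Chevalley group), exceptional and Suzuki–Ree
  groups.  TODO(general form): one `ε` for all finite groups of Lie type.

WHAT THIS IS NOT: no statement about `ω`; not a proof (named fact, D-0014: users take
`(h : BCGPU2023_cor34_typeC)`); nothing about direct powers `Sp(2n,q)^m`.
-/

noncomputable section

open scoped BigOperators

namespace Literature.Barriers.MatrixMultiplication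

open Literature.RepresentationTheory.FiniteGroups Literature.Combinatorics.Additive

/-- **BCGPU 2023, Corollary 3.4, restricted to type `C`** (p. 6: "There exists a constant `ε>0`
such that no triple product property construction in a group of Lie type can yield an upper bound
on `ω` better than `2+ε`"; footnote 2, p. 3 lists `Sp(2n,q)` among the groups of Lie type; p. 7:
"also for simple groups that are quotients of groups of Lie type by their centers").  Lean statement:
ONE absolute `ε > 0` such that for every finite field `F` and every `n ≥ 1`, every triple `S, T, U`
with the triple product property (Cohn–Umans Def. 2.1, the tree's `TripleProductProperty`) in the
symplectic group `Sp(2n, F)` (Mathlib's `Matrix.symplecticGroup (Fin n) F`, the `2n × 2n` matrices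
with `A J Aᵀ = J`), respectively in its quotient `PSp(2n, F)` by the centre, satisfies the inequality
of Thm. 2.2 (= the tree's `CKSU2005_thm18`) AT the exponent `w = 2 + ε`:
`(|S||T||U|)^{(2+ε)/3} ≤ ∑ᵢ dᵢ^{2+ε}` (`charDegreePowSum`), i.e. Thm. 2.2 cannot certify
`ω < 2 + ε` from it.  Printed proof: bounded rank by Cor. 3.3 with `n(Sp(2n,q)) ≥ Ω(qⁿ)`
(Landazuri–Seitz), large rank by `O(qⁿ)` conjugacy classes (Fulman–Guralnick) and convexity.
Statement only: the class-number input is not in the tree for `Sp` (see the module docstring; the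
type-`A` analogue `BCGPU2023_cor34_typeA` is proved); the minimal-degree input is proved in the weak
form `n(Sp(2n,q)) ≥ q^{n−1} − 1` (`SpMinimalCharacterDegree.lean`), and
`BCGPU2023_cor34_typeC_of_classNumber` (`QuasirandomBarrierLieTypeCOfClassNumber.lean`) derives this
fact from the class-number input `k(Sp(2n, 𝔽_q)) ≤ q^{5n}` alone, stated as a hypothesis.
[cite: BlasiakCohnGrochowPrattUmans2023, Cor. 3.4] -/
def BCGPU2023_cor34_typeC : Prop :=
  ∃ ε : ℝ, 0 < ε ∧ ∀ (F : Type) [Field F] [Fintype F] (n : ℕ), 1 ≤ n →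
    (∀ (S T U : Finset (Matrix.symplecticGroup (Fin n) F)), TripleProductProperty S T U →
      ((S.card * T.card * U.card : ℕ) : ℝ) ^ ((2 + ε) / 3) ≤
        charDegreePowSum (Matrix.symplecticGroup (Fin n) F) (2 + ε)) ∧
    (∀ (S T U : Finset (Matrix.symplecticGroup (Fin n) F ⧸
        Subgroup.center (Matrix.symplecticGroup (Fin n) F))), TripleProductProperty S T U →
      ((S.card * T.card * U.card : ℕ) : ℝ) ^ ((2 + ε) / 3) ≤
        charDegreePowSum (Matrix.symplecticGroup (Fin n) F ⧸
          Subgroup.center (Matrix.symplecticGroup (Fin n) F)) (2 + ε))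

/-- Projection of `BCGPU2023_cor34_typeC` on `Sp(2n, F)`. [cite: BlasiakCohnGrochowPrattUmans2023, Cor. 3.4] -/
theorem BCGPU2023_cor34_typeC.sp (h : BCGPU2023_cor34_typeC) :
    ∃ ε : ℝ, 0 < ε ∧ ∀ (F : Type) [Field F] [Fintype F] (n : ℕ), 1 ≤ n →
      ∀ (S T U : Finset (Matrix.symplecticGroup (Fin n) F)), TripleProductProperty S T U →
        ((S.card * T.card * U.card : ℕ) : ℝ) ^ ((2 + ε) / 3) ≤
          charDegreePowSum (Matrix.symplecticGroup (Fin n) F) (2 + ε) := by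
  obtain ⟨ε, hε, h⟩ := h
  exact ⟨ε, hε, fun F _ _ n hn => (h F n hn).1⟩

/-- Projection of `BCGPU2023_cor34_typeC` on the central quotients `PSp(2n, F)` ("also for simple
groups that are quotients of groups of Lie type by their centers").
[cite: BlasiakCohnGrochowPrattUmans2023, Cor. 3.4 (remark following the proof)] -/
theorem BCGPU2023_cor34_typeC.psp (h : BCGPU2023_cor34_typeC) :
    ∃ ε : ℝ, 0 < ε ∧ ∀ (F : Type) [Field F] [Fintype F] (n : ℕ), 1 ≤ n →
      ∀ (S T U : Finset (Matrix.symplecticGroup (Fin n) F ⧸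
          Subgroup.center (Matrix.symplecticGroup (Fin n) F))), TripleProductProperty S T U →
        ((S.card * T.card * U.card : ℕ) : ℝ) ^ ((2 + ε) / 3) ≤
          charDegreePowSum (Matrix.symplecticGroup (Fin n) F ⧸
            Subgroup.center (Matrix.symplecticGroup (Fin n) F)) (2 + ε) := by
  obtain ⟨ε, hε, h⟩ := h
  exact ⟨ε, hε, fun F _ _ n hn => (h F n hn).2⟩

/-- `Sp(2, F) ⊇` a copy of the TPP vocabulary: the symplectic group is a group and `J ∈ Sp(2n, F)`,
so the fact quantifies over a non-empty family of non-trivial groups (non-vacuity witness: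
`{1}, {1}, {J}` is a TPP triple). [cite: BlasiakCohnGrochowPrattUmans2023, Def. 2.1] -/
example (F : Type) [Field F] (n : ℕ) :
    TripleProductProperty ({1} : Finset (Matrix.symplecticGroup (Fin n) F)) {1}
      {SymplecticGroup.symJ (Fin n) F} := by
  intro s hs s' hs' t ht t' ht' u hu u' hu' _
  simp only [Finset.mem_singleton] at hs hs' ht ht' hu hu'
  exact ⟨hs.trans hs'.symm, ht.trans ht'.symm, hu.trans hu'.symm⟩

end Literature.Barriers.MatrixMultiplication

end
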